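import Summits.BirchSwinnertonDyer.BirchSwinnertonDyer.Theorems.Rank2ObservatoryTateDeepCert
import Literature.NumberTheory.EllipticCurves.TamagawaRingEquivProofs
import Literature.NumberTheory.EllipticCurves.NeronComponentIndexProofs
import Literature.NumberTheory.EllipticCurves.NeronComponentIndexTypeIIIProofs
import Literature.NumberTheory.EllipticCurves.NeronComponentIndexTypeIIIstarProofs
import Literature.NumberTheory.EllipticCurves.NeronComponentIndexTypeIVProofs
import Literature.NumberTheory.EllipticCurves.NeronComponentIndexTypeIVstarProofs
import Literature.NumberTheory.EllipticCurves.HasseWeilAbelianConductor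
import Summits.BirchSwinnertonDyer.BirchSwinnertonDyer.Theorems.KatoDescentTamePotSupersingularTameUpperUnitTwistRecordsSharp44
import HarnessLib

/-!
# Route `KatoDescentTamePotSupersingular` (rung K8, sub-rung B4 (t′), cell `bsd-potss`): KERNEL certificates of the ♯ records'
# displayed binder `hcp : ¬ p ∣ c_p(E)` (part 07: 1 rows — 166410bd1)
# (seat `bsd-potss-k8t-c4` g15; `--supports stmt-BirchSwinnertonDyer-19982 --as helper`)

HONEST FRAMING. THEOREMS ONLY; PER ROW; nothing is booked; items 19202 / 19982 stay OPEN at class level; BSD is not proved by any of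
this. The ♯ unit-twist records (`…RecordsSharpNN`, g14) display `hcp : ¬ p ∣ (W.baseChange ℚ_[p]).localTamagawaNumber ℤ_[p]` — the
v ∣ p Selmer step of the Jetchev road needs `p ∤ c_p`. Here it is PROVED per row: the Kodaira type at the item prime `p` (the (t′) types
`II/III/IV/IV*/III*/II*`, `e = 6/4/3`) is certified by the rank-2 observatory's integer-model certificates (`Rank2ObservatoryTateStep2Cert.sound`
for II/III/IV, `Rank2ObservatoryTateDeepCert.sound` for IV*/III*/II*, `check` by `decide`, minimality from `ord Δ < 12` resp. the row's
`isGloballyMinimal_g…`), and the tree's DISCHARGED Tate-step facts (`NeronComponentIndex*Proofs`: `c = 1` for II/II*, `2` for III/III*,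
`∈ {1,3}` for IV/IV*) give `p ∤ c_p` for the odd `p`; `localTamagawaNumber_padic_eq_holds` moves the adèlic local number to Mathlib's `ℚ_p`.

References: [SilvermanATAEC1994] IV.9.4 Steps 3–10, Rem. IV.9.3, Table 4.1; [SilvermanAEC2009] VII.6; [Cremona2006] Table 1.
-/

set_option autoImplicit false
set_option linter.dupNamespace false
noncomputable section
open scoped Classical NumberField
open WeierstrassCurve WeierstrassCurve.Rat IsDedekindDomain Rat.HeightOneSpectrum Literature.NumberTheory.DiophantineGeometry
  Literature.NumberTheory.EllipticCurves Literature.NumberTheory.EllipticCurves.Rank1Residual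
  Summit.BirchSwinnertonDyer.BirchSwinnertonDyer.Rank1Residual.IntModel
  Summit.BirchSwinnertonDyer.Rank1Residual Summit.BirchSwinnertonDyer.Rank1Residual.Additive
  Summit.BirchSwinnertonDyer.BirchSwinnertonDyer
  Summit.BirchSwinnertonDyer.BirchSwinnertonDyer.Theorems

namespace Summit.BirchSwinnertonDyer.BirchSwinnertonDyer.Theorems.TameUpperUnitTwistRecords

/-- **`166410bd1`: `3 ∤ c_3(E)`** — the ♯ record's displayed binder `hcp` as a THEOREM: Kodaira type `III*` at `3` (observatory certificate
`DeepCert.sound` on the integer model, `decide`), hence `c_3 = 2` by the tree's discharged Tate-step fact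
`localTamagawaNumber_eq_two_of_kodairaSymbolAt_eq_IIIstar`, read in Mathlib's `ℚ_3` via `localTamagawaNumber_padic_eq_holds`. [cite: SilvermanATAEC1994, IV.9.4 and Rem. IV.9.3]
[cite: Cremona2006, Table 1 (Cremona label 166410bd1)] -/
theorem localTamagawaNumber_not_dvd_g166410bd1_3 : haveI := isElliptic_g166410bd1;
    ¬ 3 ∣ ((⟨1, (-1), 1, (-5724548723), 166706400693331⟩ : WeierstrassCurve ℚ).baseChange ℚ_[3]).localTamagawaNumber ℤ_[3] := by
  haveI := isElliptic_g166410bd1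
  haveI := isGloballyMinimal_g166410bd1
  have hb : (⟨1, (-1), 1, (-5724548723), 166706400693331⟩ : WeierstrassCurve ℤ).baseChange ℚ = (⟨1, (-1), 1, (-5724548723), 166706400693331⟩ : WeierstrassCurve ℚ) := by
    ext <;> norm_num [WeierstrassCurve.baseChange, WeierstrassCurve.map]
  set v : HeightOneSpectrum (𝓞 ℚ) := (primesEquiv (R := 𝓞 ℚ)).symm ⟨3, by norm_num⟩ with hvdef
  have hv : ((primesEquiv v : Nat.Primes) : ℕ) = 3 := by rw [hvdef, Equiv.apply_symm_apply]
  have hgen : natGenerator v = 3 := hv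
  haveI := perfectField_residueField_adicCompletionIntegers (K := ℚ) v
  have hGM : ((⟨1, (-1), 1, (-5724548723), 166706400693331⟩ : WeierstrassCurve ℤ).baseChange ℚ).IsGloballyMinimal := hb ▸ isGloballyMinimal_g166410bd1
  have hK : (⟨1, (-1), 1, (-5724548723), 166706400693331⟩ : WeierstrassCurve ℚ).kodairaSymbolAt v = .IIIstar := by
    have h := (Rank2Observatory.Tate.DeepCert.sound (W₀ := (⟨1, (-1), 1, (-5724548723), 166706400693331⟩ : WeierstrassCurve ℤ)) (c := ⟨3, 7, 1, 23, 9, 9, 0⟩) v hgen (hGM.isMinimal v) (by decide +kernel)).1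
    rw [hb] at h
    exact h.trans (by decide)
  rw [localTamagawaNumber_padic_eq_holds (⟨1, (-1), 1, (-5724548723), 166706400693331⟩ : WeierstrassCurve ℚ) v 3 hv, localTamagawaNumber_eq_two_of_kodairaSymbolAt_eq_IIIstar_holds v _ hK]
  decide

end Summit.BirchSwinnertonDyer.BirchSwinnertonDyer.Theorems.TameUpperUnitTwistRecords
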